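import Literature.Analysis.FluidPDE.AncientL3BackwardLiouville
import Literature.Analysis.FluidPDE.KNSSTypeIRateMildProofs
import Literature.Analysis.FluidPDE.NSLerayHopfSereginStability
import Mathlib.MeasureTheory.Measure.Lebesgue.EqHaar
import HarnessLib

/-!
# Albritton–Barker 2019, Thm. 4.1 (`ε = 0`): reduction to the blow-down statement at unit scale

Analysis/FluidPDE proof file (theorems only: no definition, no named fact, no `sorry`) on the
discharge path of the named fact
`Literature.Analysis.FluidPDE.AlbrittonBarker2019_liouville_weakL3_backward`
(`AncientL3BackwardLiouville.lean`; D. Albritton, T. Barker, *On local Type I singularities of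
the Navier–Stokes equations and Liouville theorems*, J. Math. Fluid Mech. 21 (2019) no. 43 =
arXiv:1811.00502, §4, **Thm. 4.1**, special case `ε = 0`).

The printed proof (arXiv p. 9) argues by **zooming out**: "We construct a sequence
`(v^{(k)})_{k ∈ ℕ}` of mild solutions on `ℝ³ × ]-1,0[` by rescaling appropriately:
`v^{(k)}(x,t) = √|t_k| v(√|t_k| x, |t_k| t)`. … `‖v^{(k)}(·,-1)‖_{L^{3,∞}} ≤ M`,
`v^{(k)}(·,0) = U^{(k)} + W^{(k)}` [with `U^{(k)} → 0` in the sense of distributions] …", and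
everything else — the compactness of weak `L^{3,∞}` solutions, Prop. 4.2 (backward uniqueness),
the persistence of singularities — happens **at unit scale** for the rescaled sequence, ending in
the bound (4.4) `limsup_{k} √(|t_k|/2) ‖v‖_{L^∞(Q(√(|t_k|/2)))} < ∞`, "Hence, `v ≡ 0`".

This file separates the two layers. The **blow-down statement** (the unit-scale heart of the
proof; for `ε = 0`, where `W = 0` and only `U^{(k)} → 0` is used) is, in the tree's rendering of
the mild class (the Oseen integral equation of KNSS 2009 §4 (i), as in the named fact):

> for every finite `M` there is `S > 0` such that, whenever `u_k` (`k ∈ ℕ`) are bounded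
> continuous solutions of `u(t) = e^{(t-s)Δ}u(s) - B¹_s(u,u)(t)` (`0 ≤ s < t ≤ S`) on
> `[0, S] × ℝ³` with weakly divergence-free slices, initial slices of weak-`L³` size
> `σ³|{σ < |u_k(0)|}| ≤ M`, and final slices `u_k(S) → 0` in `𝒟'`, some subsequence is
> uniformly bounded on a backward parabolic cylinder `(S - ρ², S) × B(0, ρ)` below the vertex
> `(S, 0)`

(the freedom in `S = S(M)` is the freedom in the normalisation `|t_k| t`, used in the local-energy
route through Jia–Šverák's a priori bound; the subsequence is the one extracted by compactness).
It is taken here as an explicit hypothesis — it is not vendored as a named fact — and the file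
proves the **rescaling layer**:
`AlbrittonBarker2019_liouville_weakL3_backward_of_blowdown : blow-down statement → the fact`.
Given `v` as in the fact (bounded continuous Oseen-mild ancient solution, weak-`L³` bound `M`
along `τ_k → -∞`, final slice `v(t₀) ∈ 𝔹`), put `λ_k = √((t₀ - τ_k)/S)` (for the `k` with
`τ_k ≤ t₀ - 1`) and `u_k(s, y) = λ_k v(τ_k + λ_k² s, λ_k y)` — the tree's parabolic pull-back
`λ_k • stPull (λ_k²) λ_k τ_k 0 v` (`SpaceTimeRescaling.lean`). Then: `u_k` is continuous and
bounded on `[0, S] × ℝ³` (the window `[τ_k, t₀]` lies in `t < 0`); its slices are weakly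
divergence free (`IsWeaklyDivFree.dilate`); it solves the Oseen equation (the scaling covariance
`oseen_smul_stPull`, KNSS 2009 §1 (1.2)); `u_k(0) = λ_k v(τ_k, λ_k ·)` has the same weak-`L³`
size as `v(τ_k)` (the distribution function scales by `λ_k⁻³`, `Measure.addHaar_preimage_smul`);
and `u_k(S) = λ_k v(t₀, λ_k ·) → 0` in `𝒟'` is precisely the `𝔹`-hypothesis (b) of the fact
along `λ_k → ∞`. The blow-down statement gives `|u_{k_j}| ≤ K` on `(S - ρ², S) × B(0, ρ)` along
a subsequence, i.e. `|v(t, x)| ≤ K/λ_{k_j}` on `(t₀ - ρ²λ_{k_j}², t₀) × B(0, ρλ_{k_j})`; as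
`λ_{k_j} → ∞` this forces `v(t, x) = 0` for `t < t₀`, and at `t = t₀` by continuity ("Hence,
`v ≡ 0`", arXiv p. 9; the heat-kernel Besov bound (a) of the fact is not needed when `ε = 0`).

## Mathlib / tree search

Tree (reused by name): `stPull`, `stPull_apply` (`SpaceTimeRescaling`), `oseen_smul_stPull`
(`KNSSTypeIRateMildProofs`), `IsWeaklyDivFree.dilate` (`NSLerayHopfSereginStability`).
Mathlib: `Measure.addHaar_preimage_smul`, `finrank_euclideanSpace_fin`,
`Real.tendsto_sqrt_atTop`, `StrictMono.tendsto_atTop`, `le_of_tendsto_of_tendsto`,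
`tendsto_nhds_unique`. `lean search 'of_blowdown|liouville_weakL3'`: only the fact (2026-08-17).

## References

* D. Albritton, T. Barker, J. Math. Fluid Mech. 21 (2019), Paper No. 43 = arXiv:1811.00502, §4,
  Thm. 4.1 and its proof (arXiv p. 9: the rescaled sequence `v^{(k)}`, (4.4), "Hence `v ≡ 0`").
  [`AlbrittonBarker2019`]
* G. Koch, N. Nadirashvili, G. Seregin, V. Šverák, Acta Math. 203 (2009) = arXiv:0709.3599, §1
  (1.2) (scaling symmetry), §4 (i) (the integral equation). [`KochNadirashviliSereginSverak2009`]
-/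

noncomputable section

open MeasureTheory Set Function Filter Metric TopologicalSpace
open _root_.Topology
open scoped NNReal ENNReal RealInnerProductSpace

namespace Literature.Analysis.FluidPDE

/-! ### Two elementary lemmas -/

/-- **The weak-`L³` size is invariant under the Navier–Stokes scaling of a slice**: for `c > 0`
and `σ > 0`, `σ³ |{y : σ < |c f(c y)|}| = (σ/c)³ |{z : σ/c < |f z|}|` on `ℝ³` (the distribution
function of `y ↦ c f(cy)` at height `σ` is `c⁻³` times that of `f` at height `σ/c`,
`Measure.addHaar_preimage_smul`). [folklore] -/
theorem ofReal_pow_three_mul_volume_smul_comp_smul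
    (f : EuclideanSpace ℝ (Fin 3) → EuclideanSpace ℝ (Fin 3)) {c : ℝ} (hc : 0 < c) {σ : ℝ}
    (hσ : 0 < σ) :
    ENNReal.ofReal σ ^ 3 * volume {y : EuclideanSpace ℝ (Fin 3) | σ < ‖c • f (c • y)‖} =
      ENNReal.ofReal (σ / c) ^ 3 * volume {z : EuclideanSpace ℝ (Fin 3) | σ / c < ‖f z‖} := by
  have hc0 : c ≠ 0 := hc.ne'
  have hset : {y : EuclideanSpace ℝ (Fin 3) | σ < ‖c • f (c • y)‖} =
      (fun y : EuclideanSpace ℝ (Fin 3) => c • y) ⁻¹' {z | σ / c < ‖f z‖} := by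
    ext y
    simp only [mem_setOf_eq, mem_preimage, norm_smul, Real.norm_of_nonneg hc.le]
    rw [div_lt_iff₀ hc, mul_comm]
  rw [hset, Measure.addHaar_preimage_smul volume hc0, finrank_euclideanSpace_fin, ← mul_assoc]
  congr 1
  rw [abs_of_pos (inv_pos.2 (pow_pos hc 3)), ← ENNReal.ofReal_pow hσ.le,
    ← ENNReal.ofReal_mul (by positivity), ← ENNReal.ofReal_pow (div_pos hσ hc).le, div_pow,
    div_eq_mul_inv]

/-- A function continuous on `Iio 0` from within, vanishing on `Iio t₀` (`t₀ < 0`), vanishes at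
`t₀`. [folklore] -/
theorem eq_zero_of_continuousWithinAt_of_forall_lt {F : Type*} [NormedAddCommGroup F]
    {g : ℝ → F} {t₀ : ℝ} (ht₀ : t₀ < 0) (hg : ContinuousWithinAt g (Iio 0) t₀)
    (h : ∀ t < t₀, g t = 0) : g t₀ = 0 := by
  have h1 : Tendsto g (𝓝[<] t₀) (𝓝 (g t₀)) :=
    hg.tendsto.mono_left (nhdsWithin_mono _ fun t ht => lt_trans ht ht₀)
  have h2 : Tendsto g (𝓝[<] t₀) (𝓝 0) := by
    refine tendsto_const_nhds.congr' ?_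
    filter_upwards [self_mem_nhdsWithin] with t ht
    exact (h t ht).symm
  exact tendsto_nhds_unique h1 h2

/-! ### The reduction -/

set_option maxHeartbeats 800000 in
/-- **Albritton–Barker 2019, Thm. 4.1 (`ε = 0`) from the blow-down statement at unit scale**
(J. Math. Fluid Mech. 21 (2019) no. 43 = arXiv:1811.00502, §4, proof of Thm. 4.1, p. 9: the
rescaled sequence `v^{(k)}(x,t) = √|t_k| v(√|t_k| x, |t_k| t)`, with
`‖v^{(k)}(·,-1)‖_{L^{3,∞}} ≤ M` and `v^{(k)}(·,0) → 0` in `𝒟'`, is uniformly bounded near the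
vertex, (4.4); "Hence, `v ≡ 0`"). The hypothesis `H` is the unit-scale statement quoted in the
module docstring (bounded continuous Oseen-mild solutions on `[0, S] × ℝ³`, `S = S(M)`, with
weakly divergence-free slices, initial slices of weak-`L³` size `≤ M` and final slices tending to
`0` in `𝒟'`, are uniformly bounded on some `(S - ρ², S) × B(0, ρ)` along a subsequence); the
theorem performs the rescaling `u_k = λ_k • stPull (λ_k²) λ_k τ_k 0 v`, `λ_k² S = t₀ - τ_k`, checks
the six hypotheses of `H` (continuity and boundedness on the window `[τ_k, t₀] ⊂ {t < 0}`;
`IsWeaklyDivFree.dilate`; the scaling covariance of the Oseen equation `oseen_smul_stPull`; the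
scale invariance of the weak-`L³` size, `ofReal_pow_three_mul_volume_smul_comp_smul`; hypothesis
(b) of `𝔹` along `λ_k → ∞`), and un-scales the uniform bound: `|v(t,x)| ≤ K/λ_{k_j} → 0` for
`t < t₀`, then `t = t₀` by continuity. [cite: AlbrittonBarker2019, Thm 4.1, proof (arXiv:1811.00502 §4 p. 9)] [cite: KochNadirashviliSereginSverak2009, §1 (1.2)] -/
theorem AlbrittonBarker2019_liouville_weakL3_backward_of_blowdown
    (H : ∀ M : ℝ≥0∞, M < ∞ → ∃ S : ℝ, 0 < S ∧
      ∀ u : ℕ → ℝ → EuclideanSpace ℝ (Fin 3) → EuclideanSpace ℝ (Fin 3),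
        (∀ k, ContinuousOn (uncurry (u k)) (Icc 0 S ×ˢ univ)) →
        (∀ k, ∃ C : ℝ, ∀ t ∈ Icc 0 S, ∀ x, ‖u k t x‖ ≤ C) →
        (∀ k, ∀ t ∈ Icc 0 S, IsWeaklyDivFree (u k t)) →
        (∀ k (s t : ℝ), 0 ≤ s → s < t → t ≤ S → ∀ x,
          u k t x = UnboundedOperators.heatExtension (u k s) (t - s) x -
            oseenDuhamel 1 s (u k) (u k) t x) →
        (∀ k (σ : ℝ), 0 < σ →
          ENNReal.ofReal σ ^ 3 * volume {x : EuclideanSpace ℝ (Fin 3) | σ < ‖u k 0 x‖} ≤ M) →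
        (∀ φ : EuclideanSpace ℝ (Fin 3) → EuclideanSpace ℝ (Fin 3),
          FunctionSpaces.IsTestFunctionOn (⊤ : Opens (EuclideanSpace ℝ (Fin 3))) φ →
            Tendsto (fun k => ∫ x, ⟪u k S x, φ x⟫) atTop (𝓝 0)) →
        ∃ (φ : ℕ → ℕ) (ρ K : ℝ), StrictMono φ ∧ 0 < ρ ∧
          ∀ j, ∀ s ∈ Ioo (S - ρ ^ 2) S, ∀ y ∈ ball (0 : EuclideanSpace ℝ (Fin 3)) ρ,
            ‖u (φ j) s y‖ ≤ K) :
    AlbrittonBarker2019_liouville_weakL3_backward := by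
  intro v hcont hbdd hdiv hoseen hseq t₀ ht₀ _hBesov hB
  obtain ⟨τ, M, hM, hτ, hτneg, hweak⟩ := hseq
  obtain ⟨S, hS, HS⟩ := H M hM
  obtain ⟨Cv, hCv⟩ := hbdd
  -- ### the tail of the sequence: `τ_k ≤ t₀ - 1` for `k ≥ k₀`
  obtain ⟨k₀, hk₀⟩ : ∃ k₀ : ℕ, ∀ k, k₀ ≤ k → τ k ≤ t₀ - 1 := (tendsto_atTop_atBot.1 hτ) (t₀ - 1)
  set T : ℕ → ℝ := fun j => τ (j + k₀) with hTdef
  have hT1 : ∀ j, T j ≤ t₀ - 1 := fun j => hk₀ _ (Nat.le_add_left _ _)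
  have hTlt : ∀ j, T j < t₀ := fun j => by linarith [hT1 j]
  have hTbot : Tendsto T atTop atBot := hτ.comp (tendsto_add_atTop_nat k₀)
  -- ### the scales `λ_j = √((t₀ - T_j)/S)`
  set lam : ℕ → ℝ := fun j => Real.sqrt ((t₀ - T j) / S) with hlamdef
  have hlam_pos : ∀ j, 0 < lam j := fun j => Real.sqrt_pos.2 (div_pos (by linarith [hTlt j]) hS)
  have hlam_sq : ∀ j, lam j ^ 2 = (t₀ - T j) / S := fun j =>
    Real.sq_sqrt (div_pos (by linarith [hTlt j]) hS).le
  have hlam_sqS : ∀ j, lam j ^ 2 * S = t₀ - T j := fun j => by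
    rw [hlam_sq]; field_simp
  have hlam_top : Tendsto lam atTop atTop := by
    have h1 : Tendsto (fun j => t₀ - T j) atTop atTop :=
      tendsto_atTop_add_const_left atTop t₀ (tendsto_neg_atBot_atTop.comp hTbot)
    exact Real.tendsto_sqrt_atTop.comp (h1.atTop_div_const hS)
  -- ### the rescaled fields `u_j(s, y) = λ_j v(T_j + λ_j² s, λ_j y)`
  set u : ℕ → ℝ → EuclideanSpace ℝ (Fin 3) → EuclideanSpace ℝ (Fin 3) :=
    fun j => lam j • stPull (lam j ^ 2) (lam j) (T j) 0 v with hudef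
  have hu_apply : ∀ j s y, u j s y = lam j • v (T j + lam j ^ 2 * s) (lam j • y) := by
    intro j s y
    simp only [hudef, Pi.smul_apply, stPull_apply, zero_add]
  -- the time window: `T_j + λ_j² s ∈ [T_j, t₀]` for `s ∈ [0, S]`, in particular `< 0`
  have hwin : ∀ j, ∀ s ∈ Icc (0 : ℝ) S, T j + lam j ^ 2 * s ≤ t₀ := by
    intro j s hs
    have h1 : lam j ^ 2 * s ≤ lam j ^ 2 * S := mul_le_mul_of_nonneg_left hs.2 (sq_nonneg _)
    linarith [hlam_sqS j]
  have hwin_neg : ∀ j, ∀ s ∈ Icc (0 : ℝ) S, T j + lam j ^ 2 * s < 0 := fun j s hs =>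
    lt_of_le_of_lt (hwin j s hs) ht₀
  have htop : ∀ j, T j + lam j ^ 2 * S = t₀ := fun j => by linarith [hlam_sqS j]
  -- ### the six hypotheses of the blow-down statement
  -- (1) continuity on `[0, S] × ℝ³`
  have h1 : ∀ j, ContinuousOn (uncurry (u j)) (Icc 0 S ×ˢ univ) := by
    intro j
    have hmap : ContinuousOn (fun z : ℝ × EuclideanSpace ℝ (Fin 3) =>
        uncurry v (T j + lam j ^ 2 * z.1, lam j • z.2)) (Icc 0 S ×ˢ univ) := by
      refine hcont.comp (by fun_prop) fun z hz => ?_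
      exact ⟨hwin_neg j z.1 hz.1, mem_univ _⟩
    have e : uncurry (u j) = fun z : ℝ × EuclideanSpace ℝ (Fin 3) =>
        lam j • uncurry v (T j + lam j ^ 2 * z.1, lam j • z.2) := by
      funext z
      simp only [uncurry, hu_apply]
    rw [e]
    exact hmap.const_smul (lam j)
  -- (2) boundedness
  have h2 : ∀ j, ∃ C : ℝ, ∀ t ∈ Icc 0 S, ∀ x, ‖u j t x‖ ≤ C := by
    intro j
    refine ⟨lam j * Cv, fun t ht x => ?_⟩
    rw [hu_apply, norm_smul, Real.norm_of_nonneg (hlam_pos j).le]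
    exact mul_le_mul_of_nonneg_left (hCv _ (hwin_neg j t ht) _) (hlam_pos j).le
  -- (3) weakly divergence-free slices
  have h3 : ∀ j, ∀ t ∈ Icc 0 S, IsWeaklyDivFree (u j t) := by
    intro j t ht
    have h := (hdiv _ (hwin_neg j t ht)).dilate (hlam_pos j) (lam j)
    have e : u j t = fun y => lam j • v (T j + lam j ^ 2 * t) (lam j • y) := by
      funext y; exact hu_apply j t y
    rw [e]
    exact h
  -- (4) the Oseen integral equation (scaling covariance)
  have h4 : ∀ j (s t : ℝ), 0 ≤ s → s < t → t ≤ S → ∀ x,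
      u j t x = UnboundedOperators.heatExtension (u j s) (t - s) x -
        oseenDuhamel 1 s (u j) (u j) t x := by
    intro j s t hs hst htS x
    have hs' : T j + lam j ^ 2 * s < T j + lam j ^ 2 * t := by
      have := mul_lt_mul_of_pos_left hst (pow_pos (hlam_pos j) 2)
      linarith
    have ht' : T j + lam j ^ 2 * t < 0 := hwin_neg j t ⟨hs.trans hst.le, htS⟩
    have hv : ∀ X, v (T j + lam j ^ 2 * t) X =
        UnboundedOperators.heatExtension (v (T j + lam j ^ 2 * s))
          (T j + lam j ^ 2 * t - (T j + lam j ^ 2 * s)) X -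
          oseenDuhamel 1 (T j + lam j ^ 2 * s) v v (T j + lam j ^ 2 * t) X := fun X =>
      hoseen _ _ hs' ht' X
    have h := oseen_smul_stPull (hlam_pos j) (T j) (0 : EuclideanSpace ℝ (Fin 3)) hst hv x
    simpa only [hudef] using h
  -- (5) the weak-`L³` size of the initial slices
  have h5 : ∀ j (σ : ℝ), 0 < σ →
      ENNReal.ofReal σ ^ 3 * volume {x : EuclideanSpace ℝ (Fin 3) | σ < ‖u j 0 x‖} ≤ M := by
    intro j σ hσ
    have e : {x : EuclideanSpace ℝ (Fin 3) | σ < ‖u j 0 x‖} =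
        {x : EuclideanSpace ℝ (Fin 3) | σ < ‖lam j • v (T j) (lam j • x)‖} := by
      ext x
      simp only [mem_setOf_eq, hu_apply, mul_zero, add_zero]
    rw [e, ofReal_pow_three_mul_volume_smul_comp_smul (v (T j)) (hlam_pos j) hσ]
    exact hweak (j + k₀) (σ / lam j) (div_pos hσ (hlam_pos j))
  -- (6) the final slices tend to zero in `𝒟'`
  have h6 : ∀ φ : EuclideanSpace ℝ (Fin 3) → EuclideanSpace ℝ (Fin 3),
      FunctionSpaces.IsTestFunctionOn (⊤ : Opens (EuclideanSpace ℝ (Fin 3))) φ →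
        Tendsto (fun k => ∫ x, ⟪u k S x, φ x⟫) atTop (𝓝 0) := by
    intro φ hφ
    have h := (hB φ hφ).comp hlam_top
    refine h.congr fun j => ?_
    simp only [Function.comp_apply, hu_apply, htop]
  -- ### the blow-down statement, and un-scaling
  obtain ⟨φ, ρ, K, hφ, hρ, hbound⟩ := HS u h1 h2 h3 h4 h5 h6
  have hlamφ : Tendsto (fun j => lam (φ j)) atTop atTop := hlam_top.comp hφ.tendsto_atTop
  -- `v(t, x) = 0` for `t < t₀`
  have hlt : ∀ t < t₀, ∀ x, v t x = 0 := by
    intro t ht x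
    have hdt : 0 < t₀ - t := sub_pos.2 ht
    -- eventually the point `(t, x)` lies in the un-scaled cylinder
    have hev1 : ∀ᶠ j in atTop, (t₀ - t) / lam (φ j) ^ 2 < ρ ^ 2 := by
      have h0 : Tendsto (fun j => (t₀ - t) / lam (φ j) ^ 2) atTop (𝓝 0) := by
        have h1 : Tendsto (fun j => lam (φ j) ^ 2) atTop atTop :=
          (tendsto_pow_atTop two_ne_zero).comp hlamφ
        exact h1.inv_tendsto_atTop.const_mul (t₀ - t) |>.congr (fun j => by
          simp [div_eq_mul_inv]) |> fun h => by simpa using h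
      exact h0.eventually (gt_mem_nhds (by positivity))
    have hev2 : ∀ᶠ j in atTop, ‖x‖ / lam (φ j) < ρ := by
      have h0 : Tendsto (fun j => ‖x‖ / lam (φ j)) atTop (𝓝 0) := by
        have := hlamφ.inv_tendsto_atTop.const_mul ‖x‖
        simpa [div_eq_mul_inv] using this
      exact h0.eventually (gt_mem_nhds hρ)
    -- the bound `‖v t x‖ ≤ K / λ_{φ j}` for large `j`
    have hevb : ∀ᶠ j in atTop, ‖v t x‖ ≤ K / lam (φ j) := by
      filter_upwards [hev1, hev2] with j hj1 hj2
      set c : ℝ := lam (φ j) with hcdef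
      have hc : 0 < c := hlam_pos (φ j)
      set s : ℝ := S - (t₀ - t) / c ^ 2 with hsdef
      set y : EuclideanSpace ℝ (Fin 3) := c⁻¹ • x with hydef
      have hs : s ∈ Ioo (S - ρ ^ 2) S := by
        refine ⟨by rw [hsdef]; linarith, ?_⟩
        rw [hsdef]
        have : 0 < (t₀ - t) / c ^ 2 := div_pos hdt (pow_pos hc 2)
        linarith
      have hy : y ∈ ball (0 : EuclideanSpace ℝ (Fin 3)) ρ := by
        rw [mem_ball, dist_zero_right, hydef, norm_smul, norm_inv, Real.norm_of_nonneg hc.le,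
          ← div_eq_inv_mul]
        exact hj2
      have hb := hbound j s hs y hy
      -- identify `u (φ j) s y = c • v t x`
      have hts : T (φ j) + c ^ 2 * s = t := by
        rw [hsdef, mul_sub, mul_div_cancel₀ _ (pow_ne_zero 2 hc.ne'), hcdef, hlam_sqS]
        ring
      have hyx : c • y = x := by rw [hydef, smul_inv_smul₀ hc.ne']
      rw [hu_apply, ← hcdef, hts, hyx, norm_smul, Real.norm_of_nonneg hc.le] at hb
      rw [le_div_iff₀ hc, mul_comm]
      exact hb
    have hlim : Tendsto (fun j => K / lam (φ j)) atTop (𝓝 0) := by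
      have := hlamφ.inv_tendsto_atTop.const_mul K
      simpa [div_eq_mul_inv] using this
    have hle : ‖v t x‖ ≤ 0 := le_of_tendsto_of_tendsto tendsto_const_nhds hlim hevb
    exact norm_le_zero_iff.1 hle
  -- ### conclusion, including `t = t₀` by continuity
  intro t ht x
  rcases lt_or_eq_of_le ht with hlt' | rfl
  · exact hlt t hlt' x
  · have hcx : ContinuousWithinAt (fun s => v s x) (Iio 0) t := by
      have h := hcont.comp (f := fun s : ℝ => (s, x)) (by fun_prop)
        (fun s hs => ⟨hs, mem_univ x⟩)
      exact h.continuousWithinAt (by exact ht₀)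
    exact eq_zero_of_continuousWithinAt_of_forall_lt ht₀ hcx fun s hs => hlt s hs x

end Literature.Analysis.FluidPDE

end
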